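import Literature.Computability.Complexity.AlmostP
import Literature.Computability.Complexity.LazySamplingUniform
import Literature.Computability.QuantumComplexity.RandomOracleCylinders
import Literature.Computability.Complexity.PolyTimeCountable
import Literature.Computability.Complexity.OracleQueryMap
import Literature.Computability.Complexity.LazySamplingMachine
import Literature.Computability.Complexity.PromiseCookMachine
import Literature.Computability.QuantumComplexity.OracleSeparationBQPPH
import Mathlib.Data.Finsupp.Encodable
import HarnessLib

/-!
# Bennett–Gill's `ALMOST-P ⊆ BPP`: the proof (`almostP_subset_BPP_holds`)

Sibling proof file of `AlmostP.lean` (D-0014: the fact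
`Literature.Computability.Complexity.almostP_subset_BPP` stays a `def`). We carry out Bennett and
Gill's argument (Bennett–Gill 1981; Book–Vollmer–Wagner 1996, Thm. 3 with Prop. 1–2:
`ALMOST-P ⊆ B̃P²P ⊆ BP²P = BP_h P ⊆ BPP`) over the tree's models — G01's transcript oracle
machines `OracleAlg` / `PRel`, the random oracle `randomOracleMeasure`, `BPP = bp P` with the
counting probability `uniformProb`. The polynomial running time of the coin-flip simulator is
isolated as the statement `LazySamplingSimulatorInP` and supplied by `LazySamplingMachine.lean`
(`OracleAlg.lazyLang_mem_P`; `lazySamplingSimulatorInP_holds`):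

1. (`exists_machine_pos`) If `L ∈ P^A` for almost every `A`, then, the polynomial-time oracle
   machines being countable (`countable_setOf_isPolyTime`) and the polynomials too
   (`QuantumComplexity.countable_polynomial_nat`), some machine
   `M` with budget `q` decides `L` relative to a set of oracles of positive measure; capping its
   queries at length `q` (`OracleAlg.capQ`, no effect on those oracles) and dropping the query
   clause keeps a measurable (`isDetermined_runEvent`) set `S` of positive measure on which
   `M^A` decides `L`.
2. (density, `RandomOracleCylinders.lean`) Some finite table `τ` on a finite set `F` of strings
   has `μ (S | cylinder of τ) ≥ 3/4`.
3. (lazy sampling, `LazySampling*.lean`) For every input `x`, the probability over coins `y` that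
   the simulation of `M` — table on `F`, consistent answers to repeated queries, fresh coins for
   fresh queries — outputs `[x ∈ L]` equals `μ ({A | M^A(x) = [x ∈ L]} | cylinder) ≥ 3/4`
   (`uniformProb_correct_ge`).
4. (`almostP_subset_BPP_of_simulator`, `almostP_subset_BPP_holds`) With the simulator's
   language in `P`, `L ∈ bp P = BPP` with coin polynomial `q` and threshold `3/4 ≥ 2/3`.

Hence `fortnowRogers1999_thm44` (and reading (a) of the barrier `RandomOracleMethod`) hold
unconditionally (see `Barriers/QuantumAdvantage/RandomOracleMethodProofs.lean`).

## References

* C. H. Bennett, J. Gill, *Relative to a random oracle `A`, `P^A ≠ NP^A ≠ co-NP^A` with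
  probability 1*, SIAM J. Comput. 10 (1981) 96–113 [BennettGill1981] (acq-00719).
* R. V. Book, H. Vollmer, K. W. Wagner, *On type-2 probabilistic quantifiers*, ICALP 1996,
  LNCS 1099 [BookVollmerWagner1996], §3 Prop. 1–2 (p. 373–374), §4 Thm. 3 and (1) (p. 374–375).
* L. Fortnow, J. Rogers, JCSS 59 (1999), proof of Thm. 4.4 (arXiv:cs/9811023, p. 8).
-/

noncomputable section

namespace Literature.Computability.Complexity

open MeasureTheory QuantumComplexity _root_.Computability OracleAlg
open scoped ENNReal

/-! ### The machine fact -/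

/-- **The coin-flip simulator runs in polynomial time** (the machine half of Bennett–Gill's
`ALMOST-P ⊆ BPP`; Book–Vollmer–Wagner 1996, Prop. 1–2: the type-2 operator `BP²` over `P` is a
classical `BP` operator over coin words, "the tree of all computations of `M` on input `x` for
the different oracles is obviously finite"). For every polynomial-time oracle machine `M` (G01
transcript model) whose queries have length polynomial in the input, every finite table `τ` on a
finite set `F` of strings and every polynomial round budget `q`, the language of the pairs
`⟨x, y⟩` on which the lazy-sampling simulation of `M` on `x` with coins `y` — queries in `F`
answered by `τ`, repeated queries by their earlier answer, fresh queries by fresh coins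
(`OracleAlg.coinAns`) — accepts within `q(|x|)` rounds is in `P`. Stated as a `Prop` (the
interface between the measure-theoretic assembly and the machine construction) and proved:
`lazySamplingSimulatorInP_holds`. [cite: BookVollmerWagner1996, §3 Prop. 1–2 (p. 373–374)] -/
def LazySamplingSimulatorInP : Prop :=
  ∀ (M : OracleAlg Bool) (c : Polynomial ℕ), M.IsPolyTime encodingBoolBool →
    (∀ (x : List Bool) (as : List (List Bool)) (u : List Bool),
      M.step x as = Sum.inl u → u.length ≤ c.eval x.length) →
    ∀ (F : Finset (List Bool)) (τ : F → Bool) (q : Polynomial ℕ),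
      {w : List Bool | runWith M (boolUnpair w).1
          (coinAns M F τ (boolUnpair w).1 (boolUnpair w).2)
          (q.eval (boolUnpair w).1.length) [] = some true} ∈ Classes.P

/-- **The simulator runs in polynomial time** (`LazySamplingMachine.lean`,
`OracleAlg.lazyLang_mem_P`). [cite: BookVollmerWagner1996, §3 Prop. 1–2 (p. 373–374)] -/
theorem lazySamplingSimulatorInP_holds : LazySamplingSimulatorInP :=
  fun _ c hM hcap F τ q => OracleAlg.lazyLang_mem_P hM c hcap F τ q

/-! ### Small lemmas -/

/-- Mathlib's `Set.boolIndicator` is the classical `decide`. [folklore] -/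
theorem boolIndicator_eq_decide (A : Set (List Bool)) (u : List Bool) :
    A.boolIndicator u = @decide (u ∈ A) (Classical.propDecidable _) := by
  unfold Set.boolIndicator
  cases Classical.propDecidable (u ∈ A) <;> rfl

/-! ### Runs against a language oracle: locality and measurability -/

section Runs

variable (M : OracleAlg Bool) (x : List Bool) (k : ℕ)

/-- The run of `M` on `x` within `k` rounds against the oracle `A`, through `runWith`, only
depends on the bits of `A` in the query bound: it is the run against the table
`restrictBool V A` extended by `false`, `V = queryBound M x k F`. [folklore] -/
theorem runWith_boolIndicator_eq_extB (F : Finset (List Bool)) (A : Set (List Bool)) :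
    runWith M x (fun _ u => A.boolIndicator u) k [] =
      runWith M x (fun _ u => extB (queryBound M x k F) (restrictBool (queryBound M x k F) A) u) k [] :=
  runWith_congr_queryBound M x F fun u hu => by
    rw [extB_of_mem _ hu, restrictBool_apply, boolIndicator_eq_decide]

/-- The event "`M^A` outputs `b` on `x` within `k` rounds" is determined by the query bound. [folklore] -/
theorem isDetermined_runEvent (F : Finset (List Bool)) (b : Bool) :
    IsDetermined (queryBound M x k F)
      {A : Set (List Bool) | runWith M x (fun _ u => A.boolIndicator u) k [] = some b} := by
  intro A A' h
  simp only [Set.mem_setOf_eq]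
  rw [runWith_boolIndicator_eq_extB M x k F A, runWith_boolIndicator_eq_extB M x k F A', h]

/-- An oracle lies in the cylinder of `τ` iff its table on `V ⊇ F` agrees with `τ`. [folklore] -/
theorem restrictBool_mem_tables_iff {V F : Finset (List Bool)} (hFV : F ⊆ V) (τ : F → Bool)
    (A : Set (List Bool)) : restrictBool V A ∈ tables V F τ ↔ A ∈ oracleCylinder F τ := by
  rw [mem_tables_iff, mem_oracleCylinder_iff, funext_iff]
  refine forall_congr' fun u => ?_
  rw [extB_of_mem _ (hFV u.2), restrictBool_apply, restrictBool_apply]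

/-- The run event met with a cylinder, as a preimage of a set of tables. [folklore] -/
theorem runEvent_inter_oracleCylinder (F : Finset (List Bool)) (τ : F → Bool) (b : Bool) :
    {A : Set (List Bool) | runWith M x (fun _ u => A.boolIndicator u) k [] = some b} ∩ oracleCylinder F τ =
      {A | restrictBool (queryBound M x k F) A ∈ (tables (queryBound M x k F) F τ).filter fun B =>
        runWith M x (fun _ u => extB (queryBound M x k F) B u) k [] = some b} := by
  classical
  ext A
  simp only [Set.mem_inter_iff, Set.mem_setOf_eq, Finset.mem_filter]
  rw [restrictBool_mem_tables_iff (subset_queryBound M x k F), ← runWith_boolIndicator_eq_extB]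
  exact and_comm

/-- The cylinder itself as a preimage of the set of tables. [folklore] -/
theorem oracleCylinder_eq_preimage_tables (F : Finset (List Bool)) (τ : F → Bool) :
    oracleCylinder F τ =
      {A | restrictBool (queryBound M x k F) A ∈ tables (queryBound M x k F) F τ} := by
  ext A
  exact (restrictBool_mem_tables_iff (subset_queryBound M x k F) τ A).symm

/-- **From conditional measure to coin probability.** If a set `S` of oracles on which `M^A`
outputs `b` on `x` within `k` rounds has conditional measure `≥ 3/4` in the cylinder of `τ`,
then the lazy-sampling simulation outputs `b` with probability `≥ 3/4` over the coins. [folklore] -/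
theorem uniformProb_correct_ge {S : Set (Set (List Bool))} (F : Finset (List Bool)) (τ : F → Bool)
    (b : Bool) (hS : S ⊆ {A | runWith M x (fun _ u => A.boolIndicator u) k [] = some b})
    (hdens : (1 - 4⁻¹) * randomOracleMeasure (oracleCylinder F τ) ≤
      randomOracleMeasure (S ∩ oracleCylinder F τ)) :
    (3 / 4 : ℝ) ≤ uniformProb k {y | runWith M x (coinAns M F τ x y) k [] = some b} := by
  classical
  set V := queryBound M x k F with hV
  set T := tables V F τ with hT
  set G := T.filter fun B => runWith M x (fun _ u => extB V B u) k [] = some b with hG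
  have hcard : (1 - 4⁻¹) * (T.card : ℝ≥0∞) ≤ G.card := by
    have h1 : randomOracleMeasure (S ∩ oracleCylinder F τ) ≤ G.card * 2⁻¹ ^ V.card := by
      calc randomOracleMeasure (S ∩ oracleCylinder F τ)
          ≤ randomOracleMeasure ({A | runWith M x (fun _ u => A.boolIndicator u) k [] = some b} ∩
              oracleCylinder F τ) := measure_mono (Set.inter_subset_inter_left _ hS)
        _ = G.card * 2⁻¹ ^ V.card := by
          rw [runEvent_inter_oracleCylinder, randomOracleMeasure_restrictBool]
    have h2 : randomOracleMeasure (oracleCylinder F τ) = T.card * 2⁻¹ ^ V.card := by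
      rw [oracleCylinder_eq_preimage_tables M x k F τ, randomOracleMeasure_restrictBool]
    have h3 : (1 - 4⁻¹) * (T.card : ℝ≥0∞) * 2⁻¹ ^ V.card ≤ G.card * 2⁻¹ ^ V.card := by
      rw [mul_assoc, ← h2]; exact hdens.trans h1
    exact (ENNReal.mul_le_mul_iff_left (pow_ne_zero _ (ENNReal.inv_ne_zero.2 ENNReal.ofNat_ne_top))
      (ENNReal.pow_ne_top (ENNReal.inv_ne_top.2 (NeZero.ne 2)))).1 h3
  have hreal : (3 / 4 : ℝ) * T.card ≤ G.card := by
    have h := ENNReal.toReal_mono (ENNReal.natCast_ne_top G.card) hcard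
    rw [ENNReal.toReal_mul, ENNReal.toReal_natCast, ENNReal.toReal_natCast] at h
    convert h using 2
    rw [ENNReal.toReal_sub_of_le (by norm_num) ENNReal.one_ne_top]
    norm_num
  have hTpos : (0 : ℝ) < T.card := Nat.cast_pos.2 (Nat.pos_of_ne_zero (card_tables_ne_zero (subset_queryBound M x k F)))
  rw [uniformProb_lazySampling, ← hV, ← hT, ← hG, le_div_iff₀ hTpos]
  exact hreal

end Runs

/-! ### The countable cover, the good set, and the assembly -/

section Assembly

variable {L : Language Bool}

/-- "`M` with budget `q` decides `L` relative to `A`": the defining clause of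
`L ∈ PRel (Oracle.ofLanguage A)` for the witness `(M, q)`. [folklore] -/
def DecidesRel (L : Language Bool) (M : OracleAlg Bool) (q : Polynomial ℕ) (A : Set (List Bool)) : Prop :=
  ∀ x : List Bool, M.run (Oracle.ofLanguage A) (q.eval x.length) x = some (L.boolIndicator x) ∧
    ∀ y ∈ M.queries (Oracle.ofLanguage A) (q.eval x.length) x, y.length ≤ q.eval x.length

/-- The oracles making `L ∈ P^A` are covered by the countably many witness events. [folklore] -/
theorem setOf_mem_PRel_subset_iUnion (L : Language Bool) :
    {A : Set (List Bool) | L ∈ PRel (Oracle.ofLanguage A)} ⊆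
      ⋃ i : {M : OracleAlg Bool // M.IsPolyTime encodingBoolBool} × Polynomial ℕ,
        {A | DecidesRel L i.1.1 i.2 A} := by
  intro A hA
  obtain ⟨M, hM, q, h⟩ := mem_PRel_iff.1 hA
  exact Set.mem_iUnion.2 ⟨(⟨M, hM⟩, q), h⟩

/-- **Step 1 (countable pigeonhole).** If `L ∈ P^A` almost surely, some polynomial-time machine
with some polynomial budget decides `L` relative to a set of oracles of positive measure.
[cite: BookVollmerWagner1996, §4 Thm. 3 (p. 374, ALMOST-𝒦 ⊆ B̃P²𝒦)] -/
theorem exists_machine_pos (hL : L ∈ almostP) :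
    ∃ (M : OracleAlg Bool) (q : Polynomial ℕ), M.IsPolyTime encodingBoolBool ∧
      randomOracleMeasure {A | DecidesRel L M q A} ≠ 0 := by
  haveI : Countable (Polynomial ℕ) := QuantumComplexity.countable_polynomial_nat
  haveI : Countable {M : OracleAlg Bool // M.IsPolyTime encodingBoolBool} :=
    (countable_setOf_isPolyTime encodingBoolBool).to_subtype
  set good : {M : OracleAlg Bool // M.IsPolyTime encodingBoolBool} × Polynomial ℕ → Set (Set (List Bool)) :=
    fun i => {A | DecidesRel L i.1.1 i.2 A} with hgood
  have h0 : randomOracleMeasure {A : Set (List Bool) | ¬ L ∈ PRel (Oracle.ofLanguage A)} = 0 :=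
    ae_iff.1 (mem_almostP_iff.1 hL)
  have h1 : randomOracleMeasure (⋃ i, good i) ≠ 0 := by
    intro h
    have hle : randomOracleMeasure Set.univ ≤
        randomOracleMeasure (⋃ i, good i) + randomOracleMeasure {A | ¬ L ∈ PRel (Oracle.ofLanguage A)} := by
      refine (measure_mono fun A _ => ?_).trans (measure_union_le _ _)
      by_cases hA : L ∈ PRel (Oracle.ofLanguage A)
      · exact Or.inl (setOf_mem_PRel_subset_iUnion L hA)
      · exact Or.inr hA
    rw [h, h0, add_zero, measure_univ] at hle
    exact one_ne_zero (le_antisymm hle bot_le)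
  obtain ⟨i, hi⟩ : ∃ i, randomOracleMeasure (good i) ≠ 0 := by
    by_contra h
    push Not at h
    exact h1 (measure_iUnion_null_iff.2 h)
  exact ⟨i.1.1, i.2, i.1.2, hi⟩

/-- The good set of the capped machine: `M^A` outputs `[x ∈ L]` on every `x` (in `runWith` form). [folklore] -/
def goodSet (L : Language Bool) (M : OracleAlg Bool) (q : Polynomial ℕ) : Set (Set (List Bool)) :=
  {A | ∀ x : List Bool,
    runWith M x (fun _ u => A.boolIndicator u) (q.eval x.length) [] = some (L.boolIndicator x)}

/-- The good set is measurable (a countable intersection of determined events). [folklore] -/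
theorem measurableSet_goodSet (L : Language Bool) (M : OracleAlg Bool) (q : Polynomial ℕ) :
    MeasurableSet (goodSet L M q) := by
  have : goodSet L M q = ⋂ x : List Bool,
      {A | runWith M x (fun _ u => A.boolIndicator u) (q.eval x.length) [] = some (L.boolIndicator x)} := by
    ext A; simp [goodSet]
  rw [this]
  exact MeasurableSet.iInter fun x => (isDetermined_runEvent M x _ ∅ _).measurableSet

/-- **Capping.** On the oracles where `(M, q)` decides `L` (with queries of length `≤ q`), the
capped machine `M.capQ q false` decides `L` too; so the witness event is inside the good set of
the capped machine. [folklore] -/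
theorem decidesRel_subset_goodSet (L : Language Bool) (M : OracleAlg Bool) (q : Polynomial ℕ) :
    {A | DecidesRel L M q A} ⊆ goodSet L (M.capQ q false) q := by
  intro A hA x
  obtain ⟨hrun, hq⟩ := hA x
  rw [← run_ofLanguage_eq_runWith, (run_capQ M q false (Oracle.ofLanguage A) x _ hq).1, hrun]

/-- **Steps 2–3.** From a machine deciding `L` on a set of oracles of positive measure: a finite
table `τ` on `F` such that, for every input `x`, the lazy-sampling simulation of the capped
machine outputs `[x ∈ L]` with probability `≥ 3/4`. [cite: BookVollmerWagner1996, §4 Thm. 3 and §3 Prop. 1–2 (p. 373–374)] -/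
theorem exists_table_of_pos (L : Language Bool) (M : OracleAlg Bool) (q : Polynomial ℕ)
    (hpos : randomOracleMeasure {A | DecidesRel L M q A} ≠ 0) :
    ∃ (F : Finset (List Bool)) (τ : F → Bool), ∀ x : List Bool,
      (3 / 4 : ℝ) ≤ uniformProb (q.eval x.length) {y | runWith (M.capQ q false) x
        (coinAns (M.capQ q false) F τ x y) (q.eval x.length) [] = some (L.boolIndicator x)} := by
  set M' := M.capQ q false with hM'
  have hpos' : randomOracleMeasure (goodSet L M' q) ≠ 0 := fun h =>
    hpos (measure_mono_null (decidesRel_subset_goodSet L M q) h)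
  obtain ⟨F, τ, hdens⟩ := exists_oracleCylinder_inter_ge (measurableSet_goodSet L M' q) hpos'
    (δ := 4⁻¹) (by simp)
  exact ⟨F, τ, fun x => uniformProb_correct_ge M' x _ F τ _ (fun A (hA : A ∈ goodSet L M' q) => hA x) hdens⟩

/-- **Bennett–Gill's `ALMOST-P ⊆ BPP`, granted the polynomial running time of the simulator.**
[cite: BookVollmerWagner1996, §1 (p. 370) and §4 ((1), p. 375)] -/
theorem almostP_subset_BPP_of_simulator (hD : LazySamplingSimulatorInP) : almostP_subset_BPP := by
  intro L hL
  obtain ⟨M, q, hM, hpos⟩ := exists_machine_pos hL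
  obtain ⟨F, τ, hprob⟩ := exists_table_of_pos L M q hpos
  set M' := M.capQ q false with hM'
  have hcap : ∀ (x : List Bool) (as : List (List Bool)) (u : List Bool),
      M'.step x as = Sum.inl u → u.length ≤ q.eval x.length := fun x as u h => capQ_step_eq_inl h
  have hL'P := hD M' q (isPolyTime_capQ (eb := encodingBoolBool) hM q false) hcap F τ q
  refine ⟨_, hL'P, q, fun x => ?_⟩
  refine le_trans (by norm_num) ((hprob x).trans (PromiseCook.uniformProb_mono fun y hy => ?_))
  simp only [Set.mem_setOf_eq] at hy
  change runWith M' (boolUnpair (boolPair x y)).1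
      (coinAns M' F τ (boolUnpair (boolPair x y)).1 (boolUnpair (boolPair x y)).2)
      (q.eval (boolUnpair (boolPair x y)).1.length) [] = some true ↔ x ∈ L
  rw [boolUnpair_boolPair]
  dsimp only
  rw [hy]
  simp only [Option.some.injEq]
  exact (Set.mem_iff_boolIndicator L x).symm

/-- **Bennett–Gill's theorem `ALMOST-P ⊆ BPP`** (discharge of the named fact
`almostP_subset_BPP` of `AlmostP.lean`): every language that is in `P^A` with probability `1`
over the random oracle `A` is in `BPP`. [cite: BookVollmerWagner1996, §1 (p. 370) and §4 ((1), p. 375)] -/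
theorem almostP_subset_BPP_holds : almostP_subset_BPP :=
  almostP_subset_BPP_of_simulator lazySamplingSimulatorInP_holds

end Assembly

end Literature.Computability.Complexity

end
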